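/-
Copyright (c) 2026 the pub-hodgecm-mathlib formalisation cell (harness21).  Prover seat hodgecm-mathlib-LH4-p11 (g11), req620 Track A «(D-RAM) FOUR-FRAME» squad
((β₂) road (R-36), the K6 road — K6 DESK WORD #22 «p11: A2-ODD»: the ODD-ROW twin of ★ A2 p864849 `…InsideCellsLawFine` (LH4-p15 (g3)) over ★ F1b-ODD p864733
`rowTower_cellDiff_mul_card_eq_odd` (LH4-p12 (g9)); same inside chart ★ A1 p864708, same fine system, same ★ A2r `cellLaw_fine_of_coarse`), 2026-09-05.
-/
import Summits.HodgeConjecture.HodgeConjecture.Theorems.F0P3cDyRamInsideCellsLawFine           -- ★ A2 p864849 (LH4-p15 (g3)): `precisionLetters_insideCell` (§0, parity-free); brings ★ F1b, ★ A2r `cellLaw_fine_of_coarse`, ★ p864373 class letters, ★ `exists_repr_fixedBall_card`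
import Summits.HodgeConjecture.HodgeConjecture.Theorems.F0P3cDyRamRowTowerCellPerCellValueOddD  -- ★ F1b-ODD p864733 (LH4-p12 (g9)): `rowTower_cellDiff_mul_card_eq_odd` (★ K6-0 HEAD′ on a row tower cell of the ODD row `2b + 1 = m`)
import HarnessLib

/-!
# Crux `H413`, line LH4 «(D-RAM) FOUR-FRAME» — (β₂) road, the K6 road, A2-ODD: «THE INSIDE CELLS' LAW ON ONE FINE DIGIT SYSTEM, ODD ROW» — for the general block
# `(H₂, h_W, φ, h, f)`, in ‹CORE-ODD.letter.v1›'s frame + the K6 floor `4d ≤ N₀ ≤ m`, on the live ODD row `2b + 1 = m` (`d` odd, `|2| < 1`), with the row's inside chart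
# (★ A1 p864708) and ONE σ-fixed integral digit system `Rd⋆` mod `|ϖ|^{n⋆}`, `n⋆ ≥ b + 2(N − 1)`: `∀ i < N, X(b+2i)·#(Rd⋆.filter LIT_i) = n(b+2i)·(ω(−h_W)·Σ_{V ∈ Rd⋆.filter LIT_i} ω(α₁ + γ₁V))`

Cell `hodgecm-mathlib` (D-0151), FLOOR 0, crux item H413 = `stmt-HodgeConjecture-24833`, route of record `HCCMUnconditional`; squad F0∕P3c∕LH4; lane
`--supports stmt-HodgeConjecture-24833 --as helper` (count-neutral; pays NO tier-0 row).  THEOREMS ONLY (no `def`, no instance, no notation, no `sorry`, default heartbeats);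
★-only imports; states NO law; ‹CORE›∕‹CORE-ODD›∕(β₂) stay HYPOTHESES of their consumers.

WHAT (K6 DESK WORD #22; the assembly DAG A1–A6 of `core_holds` ∕ `coreOdd_holds`, WORD #17).  ★ A2 `…InsideCellsLawFine.insideCells_law_fine` is the EVEN-row case (`2b = m`,
`d % 2 = 0`, over ★ F1b).  On the live ODD row `2b + 1 = m` (`d % 2 = 1`, the dyadic letter `¬ IsUnit (2 : 𝒪[E])` = ‹CORE-ODD.v1›'s `_h2`), with the SAME window `jl = m + 2N`,
the SAME inside cells `(b + 2i, b)`, `i < N`, the SAME inside chart (★ A1 p864708: `|ξ₀|·|jEϖ|^jl = |jEϖ|^(m+2)`, i.e. `|ξ₀| = exp 2(N − 1)`; at `g = 1` this is ★ F1b-ODD's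
`hξv : … = |jEϖ|^(2b + 2·1 + 1)`) and the SAME fine system `Rd⋆`, ★ F1b-ODD `…RowTowerCellPerCellValueOddD.rowTower_cellDiff_mul_card_eq_odd` replaces ★ F1b; the class letters
(★ p864373), the floor letters (`m⋆ = 2d`, `m_c = 3d − 1 ≤ 4d ≤ N₀ ≤ m`), the cell letters (`j + b + 2·1 + 1 ≤ jl ⟺ i + 1 ≤ N`, `j + m⋆ ≤ jl`) and the precision letters (★ A2 §0
`precisionLetters_insideCell`, PARITY-FREE: read at `(m, jl) := (2b, 2b + 2N)` after shifting `hξv` by one power of `|jEϖ|`, §0 here) are discharged exactly as in ★ A2.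
* §0 `v_xi_shift_odd` — `|ξ₀|·|jEϖ|^jl = |jEϖ|^(m+2)`, `2b + 1 = m`, `m + 2N = jl` ⟹ `|ξ₀|·|jEϖ|^(2b + 2N) = |jEϖ|^(2b + 2)` (so ★ A2 §0 applies verbatim).
* §1 `insideCell_law_coarse_odd` — ★ F1b-ODD on ONE inside cell `i < N` at its own resolution `|ϖ|^{b + 2(N−1−i)}` (the odd twin of ★ A2 §1; RAW output bytes with `.filter ⊤`).
* §2 HEAD `insideCells_law_fine_odd` — every inside cell's law on ONE fine system `Rd⋆` (the odd twin of ★ A2 HEAD; conclusion bytes = A2's, frames `f ∕ h` unchanged — the `hlawH`∕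
  `hlawA` letters of ★ A4 p864797 `…InsideWindowIdentity.insideWindow_identity` for `coreOdd_holds`).
WHAT IS NOT CLAIMED: the odd-row density (A3-odd), the odd top ∕ boundary cell (A5-odd), any character-sum value, any census identity.
HONEST LABEL.  Count-neutral assembly of ★ pieces; nothing printed is asserted; no census law is stated; `HC_CM` is proved only modulo the 7 printed citations (2 remaining named
inputs: hLiu418 = `stmt-HodgeConjecture-24832`, h413 = `stmt-HodgeConjecture-24833`) until rung 0 closes.
## References
* [Kottwitz1986BaseChangeUnits] R. E. Kottwitz, *Base change for unit elements of Hecke algebras*, Compositio Math. 60 (1986): §1 pp. 240–241 (signed lattice counts cell by cell).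
* [LabesseLanglands1979] J.-P. Labesse, R. P. Langlands, *L-indistinguishability for SL(2)*, Canad. J. Math. 31 (1979): §2 (2.2) p. 9 (κ-signed counts).
* [Rogawski1990] J. D. Rogawski, *Automorphic Representations of Unitary Groups in Three Variables*, Ann. of Math. Stud. 123 (1990): §4.9 Prop. 4.9.1 (b) p. 55.
* [Serre1979] J.-P. Serre, *Local Fields*, GTM 67 (1979): Ch. IV §2 Prop. 6 (digit systems); Ch. V §3 Prop. 5, Cor. 2–3 pp. 84–86; Ch. XV §2 (the conductor of the norm-residue sign).
-/

set_option autoImplicit false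

noncomputable section

namespace Summit.HodgeConjecture.HodgeConjecture.Cruxes.H413.F0P3cDyRamInsideCellsLawFineOdd

open scoped Valued WithZero Matrix MatrixGroups Classical
open WithZero Finset
open Literature.NumberTheory.Automorphic Literature.NumberTheory.Automorphic.HermitianLattice Literature.NumberTheory.Automorphic.UnitaryLatticeTree
open Literature.NumberTheory.Automorphic.UnitaryThreeFourFrame (IsRamifiedQuadraticDatum normSign)
open Literature.NumberTheory.Rogawski1990
open Summit.HodgeConjecture.HodgeConjecture.Cruxes.H413.F0P3cDyRamFourFramePieces
open Summit.HodgeConjecture.HodgeConjecture.Cruxes.H413.F0P3cDyRamFourFrameCensusDefs (LatticeInLevel LatticeNearTransvShell)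
open Summit.HodgeConjecture.HodgeConjecture.Cruxes.H413.F0P3cDyRamStageOneBDefs (mcOfRecord)
open Summit.HodgeConjecture.HodgeConjecture.Cruxes.H413.F0P3cDyRamToricCensusDefs
open Summit.HodgeConjecture.HodgeConjecture.Cruxes.H413.F0P3cDyRamRowCellOnShell (uniformizer_letters)
open Summit.HodgeConjecture.HodgeConjecture.Cruxes.H413.F0P3cDyRamRowTowerCellPerCellValueOddD (rowTower_cellDiff_mul_card_eq_odd)
open Summit.HodgeConjecture.HodgeConjecture.Cruxes.H413.F0P3cDyRamInsideCellsLawFine (precisionLetters_insideCell)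
open Summit.HodgeConjecture.HodgeConjecture.Cruxes.H413.F0P3cDyRamCellLawCommonResolution (cellLaw_fine_of_coarse)
open Summit.HodgeConjecture.HodgeConjecture.Cruxes.H413.F0P3cDyRamRamKFrameClassLetters (fgap_of_datum deep_of_datum dich_of_datum exists_flipWitness_of_frame)
open Summit.HodgeConjecture.HodgeConjecture.Cruxes.H413.F0P3cDyRamDiagonalFixedClassSystems (exists_repr_fixedBall_card)

variable {E M : Type} [Field E] [Valued E ℤᵐ⁰] [Field M] [Valued M ℤᵐ⁰]

/-! ## §0 The inside chart on the odd row, shifted to ★ A2's parity-free precision reading -/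

/-- **THE CHART SIZE, SHIFTED**: on the odd row `2b + 1 = m` with window `m + 2N = jl`, the inside chart's `|ξ₀|·|jEϖ|^jl = |jEϖ|^(m+2)` reads `|ξ₀|·|jEϖ|^(2b + 2N) = |jEϖ|^(2b + 2)`
(cancel one power of `|jEϖ| ≠ 0`) — so ★ A2 §0 `precisionLetters_insideCell` applies at `(m, jl) := (2b, 2b + 2N)`. [cite: Serre1979, Ch. IV §2 Prop. 6] -/
theorem v_xi_shift_odd {σ : E →+* E} {ϖ : E} {d tE : ℕ} (hD : IsRamifiedQuadraticDatum σ ϖ d tE)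
    (jE : E →+* M) (hjiso : ∀ a, Valued.v (jE a) = Valued.v a) {m jl b N : ℕ} (hb2 : 2 * b + 1 = m) (hNjl : m + 2 * N = jl)
    {ξ₀ : M} (hξv : Valued.v ξ₀ * Valued.v (jE ϖ) ^ jl = Valued.v (jE ϖ) ^ (m + 2)) :
    Valued.v ξ₀ * Valued.v (jE ϖ) ^ (2 * b + 2 * N) = Valued.v (jE ϖ) ^ (2 * b + 2) := by
  obtain ⟨-, -, hϖ, -, -, -, -⟩ := id hD
  have hvjϖ0 : Valued.v (jE ϖ) ≠ 0 := by rw [hjiso, hϖ]; exact exp_ne_zero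
  have h1 : Valued.v ξ₀ * Valued.v (jE ϖ) ^ (2 * b + 2 * N) * Valued.v (jE ϖ) = Valued.v (jE ϖ) ^ (2 * b + 2) * Valued.v (jE ϖ) := by
    rw [mul_assoc, ← pow_succ, ← pow_succ, show 2 * b + 2 * N + 1 = jl by omega, show 2 * b + 2 + 1 = m + 2 by omega, hξv]
  exact mul_right_cancel₀ hvjϖ0 h1

/-! ## §1 ★ F1b on ONE inside cell `i < N` at its own resolution `|ϖ|^{b + 2(N−1−i)}`, every letter but frame ∕ floor ∕ row ∕ chart ∕ system discharged -/

/-- **«THE INSIDE CELL'S LAW AT ITS OWN RESOLUTION, ODD ROW».**  General block `(H₂, h_W, φ, h, f)` in ‹CORE-ODD.letter.v1›'s frame (one-block half, binders BY NAME) + the K6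
floor `4d ≤ N₀ ≤ m`, `|u₀₀ − 1| ≤ |ϖ|^{N₀}`, `|lam − 1| ≤ |jEϖ|^{N₀}`; the live ODD row `2b + 1 = m`, `d` odd, `¬ IsUnit (2 : 𝒪[E])`, window `m + 2N = jl`; the row's INSIDE CHART
(★ A1 p864708's output letters BY NAME: `hκ₀ hΘκ₀ hκ₀v hξ hΘξ hξv hμab hR₀ hγ₀ hα₁σ hα₁1 hγ₁σ hγ₁v haff`); an inside cell `i < N`; a digit system `Rd` of σ-fixed integral elements,
complete and irredundant for the fixed unit ball modulo `|ϖ|^{b + 2(N−1−i)}`.  THEN ★ F1b-ODD's K6-0 law on the cell `(b + 2i, b)` and the system `Rd` — its RAW output bytes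
(with the `.filter (fun _ => True)`). [cite: Kottwitz1986BaseChangeUnits, §1 pp. 240–241] [cite: LabesseLanglands1979, §2 (2.2) p. 9] [cite: Rogawski1990, §4.9 Prop. 4.9.1 (b) p. 55]
[cite: Serre1979, Ch. V §3 Cor. 3; Ch. XV §2] -/
theorem insideCell_law_coarse_odd [CompleteSpace E] [IsDiscreteValuationRing 𝒪[E]] [Finite 𝓀[E]] [CompleteSpace M] [Finite 𝓀[M]]
    (σ : E →+* E) (ϖ : E) (d tE : ℕ) (hD : IsRamifiedQuadraticDatum σ ϖ d tE)
    (jE : E →+* M) (ρ Θ : M →+* M) (α lam : M)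
    (hρρ : ∀ z, ρ (ρ z) = z) (hvρ : ∀ z, Valued.v (ρ z) = Valued.v z)
    (hjv : ∀ a, Valued.v (jE a) ≤ 1 ↔ Valued.v a ≤ 1) (hjfix : ∀ z : M, ρ z = z ↔ ∃ a, jE a = z) (hΘj : ∀ a, Θ (jE a) = jE (σ a))
    (hΘΘ : ∀ z, Θ (Θ z) = z) (hΘρ : ∀ z, Θ (ρ z) = ρ (Θ z)) (hvΘ : ∀ z, Valued.v (Θ z) = Valued.v z)
    (hα : ρ α ≠ α) (hα1 : Valued.v α ≤ 1) (hint : ∀ z : M, Valued.v z ≤ 1 → Valued.v ((z - ρ z) / (α - ρ α)) ≤ 1)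
    (hΘlam : Θ lam * lam = 1) (hvlam : Valued.v lam = 1) (hU : Valued.v (α - ρ α) = 1) (hτ : Valued.v (α - Θ α) < 1)
    (hσres : ∀ z : M, ρ z = z → Valued.v z ≤ 1 → Valued.v (Θ z - z) < 1)
    (hDM : IsRamifiedQuadraticDatum Θ (jE ϖ) d tE) (hjiso : ∀ a, Valued.v (jE a) = Valued.v a)
    (hq : Nat.card 𝓀[M] = Nat.card 𝓀[E] ^ 2) (hjpow : ∀ (t : E) (n : ℤ), Valued.v (jE t) = Valued.v (jE ϖ) ^ n ↔ Valued.v t = Valued.v ϖ ^ n)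
    (hϖmax : ∀ t : M, ρ t = t → Valued.v t < 1 → Valued.v t ≤ Valued.v (jE ϖ))
    (γ₂ : GL (Fin 2) E) (u : GL (Fin 1) E) (m jl : ℕ) (hm : Valued.v (lam - jE ((u : Matrix (Fin 1) (Fin 1) E) 0 0)) = WithZero.exp (-(m : ℤ)))
    (hjl : Valued.v ((lam - jE ((u : Matrix (Fin 1) (Fin 1) E) 0 0)) - ρ (lam - jE ((u : Matrix (Fin 1) (Fin 1) E) 0 0))) = WithZero.exp (-(jl : ℤ)))
    (hum : Valued.v (((u : Matrix (Fin 1) (Fin 1) E) 0 0) - 1) ≤ Valued.v (ϖ ^ mstarOfRecord d))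
    -- the general block
    (H₂ : Matrix (Fin 2) (Fin 2) E) (hW : E) (hH₂ : IsUnit H₂.det) (hH₂σ : (H₂.map σ)ᵀ = H₂) (hhW : Valued.v hW = 1) (hhWσ : σ hW = hW)
    (P₁ : GL (Fin 3) E) (hA : formCongr σ P₁ ((StdForm.antidiagonal 3).over E) = (!![H₂ 0 0, 0, H₂ 0 1; 0, hW, 0; H₂ 1 0, 0, H₂ 1 1] : Matrix (Fin 3) (Fin 3) E))
    (hΓ : P₁ * endoGL (γ₂, u) * P₁⁻¹ ∈ unitaryGroupOfForm σ ((StdForm.antidiagonal 3).over E))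
    (φ : (Fin 2 → E) →+ M) (h : M) (hφs : ∀ (c : E) (x : Fin 2 → E), φ (c • x) = jE c * φ x) (hφi : Function.Injective φ) (hφo : Function.Surjective φ)
    (hφγ : ∀ x, φ ((γ₂ : Matrix (Fin 2) (Fin 2) E).mulVec x) = lam * φ x)
    (hform : ∀ x y, jE (pairing σ H₂ x y) = h * Θ (φ x) * φ y + ρ (h * Θ (φ x) * φ y)) (hΘh : Θ h = h) (hh : h ≠ 0)
    (f : ℕ → ℕ → AddSubgroup M → ℕ) (hfinLS : ∀ j a, (levelSet ρ Θ α (jE ϖ) h j a).Finite)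
    (hf : ∀ (b j : ℕ) (Λ : AddSubgroup M) (x₀ : M) (r : E), 1 ≤ b → x₀ ≠ 0 → (∀ x, x ∈ Λ ↔ ∃ z, IsOrd ρ α (jE ϖ ^ j) z ∧ x = x₀ * z) →
      IsOrd ρ α (jE ϖ ^ j) (dualGen ρ Θ α (jE ϖ ^ j) h x₀) → ¬ IsOrd ρ α (jE ϖ ^ j) (dualGen ρ Θ α (jE ϖ ^ j) h x₀ / jE ϖ) → Valued.v (dualGen ρ Θ α (jE ϖ ^ j) h x₀) = Valued.v (jE ϖ) ^ b →
      (∀ b', (∀ x ∈ Λ, Valued.v (h * Θ x * b' + ρ (h * Θ x * b')) ≤ 1) → (lam - jE ((u : Matrix (Fin 1) (Fin 1) E) 0 0)) * b' ∈ Λ) → IsOrd ρ α (jE ϖ ^ j) lam →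
      jE r = glueUnit ρ Θ α (jE ϖ ^ j) h (jE ϖ) (jE hW) x₀ b →
      f b j Λ = Nat.card {x : 𝒪[E] ⧸ 𝓂[E] ^ (2 * b) // ∃ u' : 𝒪[E], Ideal.Quotient.mk (𝓂[E] ^ (2 * b)) u' = x ∧ Valued.v ((u' : E) * σ u' - r) ≤ Valued.v (ϖ ^ (2 * b))})
    -- the K6 floor (‹CORE.v1›'s `_hNm _hu1N _hlam1` at the assembler's fence value `N₀`, and `4d ≤ N₀`)
    {N₀ : ℕ} (h4d : 4 * d ≤ N₀) (hN₀m : N₀ ≤ m)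
    (hu1N : Valued.v (((u : Matrix (Fin 1) (Fin 1) E) 0 0) - 1) ≤ Valued.v (ϖ ^ N₀)) (hlam1 : Valued.v (lam - 1) ≤ Valued.v (jE ϖ ^ N₀))
    -- the live ODD row, the dyadic letter (‹CORE-ODD.v1›'s `_h2`) and the window
    (b : ℕ) (hb2 : 2 * b + 1 = m) (hd1 : d % 2 = 1) (h2 : ¬ IsUnit (2 : 𝒪[E])) {N : ℕ} (hNjl : m + 2 * N = jl)
    -- the inside chart (★ A1 p864708's letters)
    {κ₀ ξ₀ : M} (hκ₀ : κ₀ + ρ κ₀ = 1) (hΘκ₀ : Θ κ₀ = κ₀) (hκ₀v : Valued.v κ₀ = 1) (hξ : ρ ξ₀ = -ξ₀) (hΘξ : Θ ξ₀ = ξ₀)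
    (hξv : Valued.v ξ₀ * Valued.v (jE ϖ) ^ jl = Valued.v (jE ϖ) ^ (m + 2))
    {μa μb R₀ γ₀ : E} (hμab : lam - jE ((u : Matrix (Fin 1) (Fin 1) E) 0 0) = jE μa + jE μb * α)
    (hR₀ : jE R₀ = α * κ₀ + ρ (α * κ₀)) (hγ₀ : jE γ₀ = ξ₀ * (α - ρ α))
    {α₁ γ₁ : E} (hα₁σ : σ α₁ = α₁) (hα₁1 : Valued.v α₁ = 1) (hγ₁σ : σ γ₁ = γ₁) (hγ₁v : Valued.v γ₁ = Valued.v ϖ ^ 2)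
    (haff : ∀ (T W f : E), σ T = T → Valued.v T = 1 → σ W = W → Valued.v W ≤ 1 → σ f = f →
      Valued.v (T * ((μa + μb * R₀) * ((ϖ * σ ϖ) ^ b)⁻¹ + μb * γ₀ * ((ϖ * σ ϖ) ^ b)⁻¹ * W) - f * ((ϖ - σ ϖ) * ((ϖ * σ ϖ) ^ ((d - d % 2) / 2))⁻¹)) ≤
        Valued.v ϖ ^ mstarOfRecord d → normSign σ f = normSign σ T * normSign σ (α₁ + γ₁ * W))
    -- the inside cell and its digit system
    {i : ℕ} (hi : i < N)
    (Rd : Finset E) (hRd1 : ∀ V ∈ Rd, σ V = V ∧ Valued.v V ≤ 1)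
    (hRd2 : ∀ V : E, σ V = V → Valued.v V ≤ 1 → ∃ V₀ ∈ Rd, Valued.v (V - V₀) ≤ Valued.v ϖ ^ (b + 2 * (N - 1 - i)))
    (hRd3 : ∀ V ∈ Rd, ∀ V' ∈ Rd, Valued.v (V - V') ≤ Valued.v ϖ ^ (b + 2 * (N - 1 - i)) → V = V') :
    (((∑ᶠ Λ ∈ levelSetDep ρ Θ α (jE ϖ) h (b + 2 * i) b (lam - jE ((u : Matrix (Fin 1) (Fin 1) E) 0 0)) ∩
                      {Λ | ∃ B : Submodule 𝒪[E] (Fin 2 → E), B.toAddSubgroup.map φ = Λ ∧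
                        ∃ L₃ : Submodule 𝒪[E] (Fin 3 → E), IsSelfDualLattice σ ϖ (!![H₂ 0 0, 0, H₂ 0 1; 0, hW, 0; H₂ 1 0, 0, H₂ 1 1] : Matrix (Fin 3) (Fin 3) E) L₃ ∧
                          L₃ ⊓ LinearMap.ker ((LinearMap.proj (1 : Fin 3) : (Fin 3 → E) →ₗ[E] E).restrictScalars 𝒪[E]) =
                            B.map ((Matrix.toLin' (!![1, 0; 0, 0; 0, 1] : Matrix (Fin 3) (Fin 2) E)).restrictScalars 𝒪[E]) ∧
                          (∀ c : E, (Pi.single 1 c : Fin 3 → E) ∈ L₃ ↔ Valued.v c ≤ Valued.v ϖ ^ b) ∧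
                          (LatticeNearTransvShell ϖ (d % 2) (mstarOfRecord d) ((((endoGL (γ₂, u) : GL (Fin 3) E) : Matrix (Fin 3) (Fin 3) E) - 1)) L₃ ∧
                            {z : E | ∃ y ∈ L₃, Valued.v ((ϖ ^ (mstarOfRecord d))⁻¹ * (z - pairing σ (!![H₂ 0 0, 0, H₂ 0 1; 0, hW, 0; H₂ 1 0, 0, H₂ 1 1] : Matrix (Fin 3) (Fin 3) E) y (((((endoGL (γ₂, u) : GL (Fin 3) E) : Matrix (Fin 3) (Fin 3) E) - 1)) *ᵥ y))) ≤ 1} =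
                              valueSetMod σ ϖ (mstarOfRecord d) (xPlus σ ϖ d))}, f b (b + 2 * i) Λ : ℕ) : ℤ) -
                  ((∑ᶠ Λ ∈ levelSetDep ρ Θ α (jE ϖ) h (b + 2 * i) b (lam - jE ((u : Matrix (Fin 1) (Fin 1) E) 0 0)) ∩
                      {Λ | ∃ B : Submodule 𝒪[E] (Fin 2 → E), B.toAddSubgroup.map φ = Λ ∧
                        ∃ L₃ : Submodule 𝒪[E] (Fin 3 → E), IsSelfDualLattice σ ϖ (!![H₂ 0 0, 0, H₂ 0 1; 0, hW, 0; H₂ 1 0, 0, H₂ 1 1] : Matrix (Fin 3) (Fin 3) E) L₃ ∧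
                          L₃ ⊓ LinearMap.ker ((LinearMap.proj (1 : Fin 3) : (Fin 3 → E) →ₗ[E] E).restrictScalars 𝒪[E]) =
                            B.map ((Matrix.toLin' (!![1, 0; 0, 0; 0, 1] : Matrix (Fin 3) (Fin 2) E)).restrictScalars 𝒪[E]) ∧
                          (∀ c : E, (Pi.single 1 c : Fin 3 → E) ∈ L₃ ↔ Valued.v c ≤ Valued.v ϖ ^ b) ∧
                          (LatticeNearTransvShell ϖ (d % 2) (mcOfRecord d) ((((endoGL (γ₂, u) : GL (Fin 3) E) : Matrix (Fin 3) (Fin 3) E) - 1)) L₃ ∧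
                            ¬ {z : E | ∃ y ∈ L₃, Valued.v ((ϖ ^ (mstarOfRecord d))⁻¹ * (z - pairing σ (!![H₂ 0 0, 0, H₂ 0 1; 0, hW, 0; H₂ 1 0, 0, H₂ 1 1] : Matrix (Fin 3) (Fin 3) E) y (((((endoGL (γ₂, u) : GL (Fin 3) E) : Matrix (Fin 3) (Fin 3) E) - 1)) *ᵥ y))) ≤ 1} =
                              valueSetMod σ ϖ (mstarOfRecord d) (xPlus σ ϖ d))}, f b (b + 2 * i) Λ : ℕ) : ℤ)) *
        ((Rd.filter (fun V₀ : E => Valued.v (κ₀ + jE V₀ * ξ₀) * Valued.v (jE ϖ ^ (b + 2 * i) * (α - ρ α)) = Valued.v (jE ϖ) ^ b ∧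
        ∃ e : M, ρ e = e ∧ e * Θ e = (κ₀ + jE V₀ * ξ₀) * ρ (κ₀ + jE V₀ * ξ₀) / (h * ρ h))).card : ℤ) =
      ((∑ᶠ Λ ∈ levelSetDep ρ Θ α (jE ϖ) h (b + 2 * i) b (lam - jE ((u : Matrix (Fin 1) (Fin 1) E) 0 0)), f b (b + 2 * i) Λ : ℕ) : ℤ) *
        (normSign σ (-hW) * ∑ V ∈ (Rd.filter (fun V₀ : E => Valued.v (κ₀ + jE V₀ * ξ₀) * Valued.v (jE ϖ ^ (b + 2 * i) * (α - ρ α)) = Valued.v (jE ϖ) ^ b ∧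
        ∃ e : M, ρ e = e ∧ e * Θ e = (κ₀ + jE V₀ * ξ₀) * ρ (κ₀ + jE V₀ * ξ₀) / (h * ρ h))).filter (fun _ => True), normSign σ (α₁ + γ₁ * V)) := by
  classical
  obtain ⟨-, -, hϖ, -, -, hdpos, -⟩ := id hD
  obtain ⟨-, hϖlt, -, -, -, -, hjϖle⟩ := uniformizer_letters jE hjv hϖ
  -- the FLOOR letters: `m⋆ = 2d`, `m_c = 3d − 1 ≤ 4d ≤ N₀ ≤ m = 2b + 1`
  have hm1 : mstarOfRecord d = 2 * d := by simp only [mstarOfRecord]; omega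
  have hmc : mcOfRecord d = 3 * d - 1 := by simp only [mcOfRecord, mstarOfRecord]; omega
  have hmcm : mcOfRecord d ≤ m := by omega
  have hdb : 2 * d ≤ b := by omega
  have hlamn : Valued.v (lam - 1) ≤ Valued.v (jE ϖ) ^ mcOfRecord d := by
    refine hlam1.trans ?_
    rw [Valuation.map_pow]
    exact pow_le_pow_right_of_le_one' hjϖle (by omega)
  have hun : Valued.v ((u : Matrix (Fin 1) (Fin 1) E) 0 0 - 1) ≤ Valued.v ϖ ^ mcOfRecord d := by
    refine hu1N.trans ?_
    rw [Valuation.map_pow]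
    exact pow_le_pow_right_of_le_one' hϖlt.le (by omega)
  -- the CLASS letters of the frame (★ p864373)
  have hFgap : ∀ z : M, ρ z = z → Θ z = z → Valued.v (jE ϖ) < Valued.v z → Valued.v z ≤ 1 → Valued.v z = 1 := fgap_of_datum hDM
  have hdeep₂ : ∀ w : M, ρ w = w → Θ w = w → Valued.v (w - 1) ≤ Valued.v (jE ϖ) ^ (2 * d) → ∃ c : M, ρ c = c ∧ c * Θ c = w :=
    deep_of_datum hD jE hjv hjfix hΘj (by omega)
  have hdeep : ∀ w : M, ρ w = w → Θ w = w → Valued.v (w - 1) ≤ Valued.v (jE ϖ) ^ (2 * d - 1) → ∃ c : M, ρ c = c ∧ c * Θ c = w :=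
    deep_of_datum hD jE hjv hjfix hΘj le_rfl
  obtain ⟨c₀, -, hc₀1, -, hdich⟩ := dich_of_datum hDM
  have hwit : ∃ a : M, Θ a = a ∧ Valued.v a = 1 ∧ ¬ ∃ e : M, ρ e = e ∧ e * Θ e = a * ρ a :=
    exists_flipWitness_of_frame hD jE hjiso hjfix hΘj hρρ hvρ hΘρ hα1 hU hDM hq hσres hτ
  -- the CHART sizes: F1b-ODD's `hξv` at `g = 1`, `|γ₁| < 1`
  have hξv₁ : Valued.v ξ₀ * Valued.v (jE ϖ) ^ jl = Valued.v (jE ϖ) ^ (2 * b + 2 * 1 + 1) := by rw [hξv]; congr 1; omega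
  have hγ₁1 : Valued.v γ₁ < 1 := by rw [hγ₁v]; exact pow_lt_one₀ zero_le hϖlt (by norm_num)
  -- the CELL letters of `(b + 2i, b)`, `i < N`
  have hbj : b ≤ b + 2 * i := by omega
  have hjm : b + 2 * i + mstarOfRecord d ≤ jl := by omega
  have hcell : b + 2 * i + b + 2 * 1 + 1 ≤ jl := by omega
  -- the PRECISION letters at `r := |ϖ|^{b + 2(N−1−i)}`, `r₀ := |jEϖ|^{2d−1}` (★ A2 §0 at `(m, jl) := (2b, 2b + 2N)`, parity-free)
  obtain ⟨hprod, hrR, hr₀, hrγ⟩ := precisionLetters_insideCell hD jE hjiso hU (m := 2 * b) (jl := 2 * b + 2 * N) rfl rfl hdb hi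
    (v_xi_shift_odd hD jE hjiso hb2 hNjl hξv) hγ₁v
  -- ★ F1b-ODD on the cell, every letter by name
  exact rowTower_cellDiff_mul_card_eq_odd σ ϖ d tE hD jE ρ Θ α lam hρρ hvρ hjv hjfix hΘj hΘΘ hΘρ hvΘ hα hα1 hint hvlam hU hjiso hjpow hϖmax γ₂ u m jl hm hjl hum
    H₂ hW hH₂ hH₂σ hhW hhWσ φ h hφs hφi hφo hφγ hform hΘh hh f hf hfinLS b hb2 hd1 hΘlam P₁ hA hΓ hmcm hlamn hun hFgap h2 hdeep₂ hc₀1 hdich hwit hbj hjm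
    hκ₀ hΘκ₀ hκ₀v.le hξ hΘξ (le_refl 1) hcell hξv₁ hμab hR₀ hγ₀ hα₁σ hα₁1 hγ₁σ hγ₁1 haff Rd (fun V hV => (hRd1 V hV).1) hRd2 hRd3 hprod.ge hrR hr₀ hdeep hrγ

/-! ## §2 HEAD — every inside cell's law on ONE fine digit system `Rd⋆` -/

/-- **HEAD — «THE INSIDE CELLS' LAW ON ONE FINE DIGIT SYSTEM, ODD ROW» (K6 DESK WORD #22 A2-ODD).**  Frame, floor, row and chart letters of §1 (the general block `(H₂, h_W, φ, h, f)` —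
instantiate twice; ‹CORE-ODD.letter.v1›'s binders BY NAME; the K6 floor `4d ≤ N₀ ≤ m` with `_hu1N _hlam1` at `N₀`; the ODD row `2b + 1 = m`, `d % 2 = 1`, `¬ IsUnit 2`, window
`m + 2N = jl`; ★ A1 p864708's chart letters BY NAME) and ONE digit system `Rd⋆` of σ-fixed integral elements, complete and irredundant for the fixed unit ball modulo `|ϖ|^{n⋆}` with `b + 2(N − 1) ≤ n⋆` (★
`exists_repr_fixedBall_card (ρ := n⋆) (t := 0)`; the desk's `n⋆ = b + 2(N − 1)`).  THEN for every inside cell `i < N`: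
`X(b+2i)·#(Rd⋆.filter LIT_i) = n(b+2i)·(normSign σ (−h_W)·Σ_{V ∈ Rd⋆.filter LIT_i} normSign σ (α₁ + γ₁·V))`, `X`, `n` the letters' finsum bytes at `j := b + 2i`, `LIT_i` ★ F1b's literal
lambda — the `hmul` letter of ★ `…CoreOfPerCellLaws.cellValue_of_perCellLaw` per inside cell, all on `Rd⋆` (§1 on the cell's own system ★ `exists_repr_fixedBall_card (ρ := b + 2(N−1−i))
(t := 0)`, then ★ A2r `cellLaw_fine_of_coarse` at `c := h·ρh`, `C := jEϖ^{b+2i}·(α − ρα)`, `y := |jEϖ|^b`, `hPiff := Iff.rfl`) — conclusion bytes = ★ A2's.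
[cite: Kottwitz1986BaseChangeUnits, §1 pp. 240–241] [cite: LabesseLanglands1979, §2 (2.2) p. 9] [cite: Rogawski1990, §4.9 Prop. 4.9.1 (b) p. 55] [cite: Serre1979, Ch. IV §2 Prop. 6; Ch. V §3 Cor. 3] -/
theorem insideCells_law_fine_odd [CompleteSpace E] [IsDiscreteValuationRing 𝒪[E]] [Finite 𝓀[E]] [CompleteSpace M] [Finite 𝓀[M]]
    (σ : E →+* E) (ϖ : E) (d tE : ℕ) (hD : IsRamifiedQuadraticDatum σ ϖ d tE)
    (jE : E →+* M) (ρ Θ : M →+* M) (α lam : M)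
    (hρρ : ∀ z, ρ (ρ z) = z) (hvρ : ∀ z, Valued.v (ρ z) = Valued.v z)
    (hjv : ∀ a, Valued.v (jE a) ≤ 1 ↔ Valued.v a ≤ 1) (hjfix : ∀ z : M, ρ z = z ↔ ∃ a, jE a = z) (hΘj : ∀ a, Θ (jE a) = jE (σ a))
    (hΘΘ : ∀ z, Θ (Θ z) = z) (hΘρ : ∀ z, Θ (ρ z) = ρ (Θ z)) (hvΘ : ∀ z, Valued.v (Θ z) = Valued.v z)
    (hα : ρ α ≠ α) (hα1 : Valued.v α ≤ 1) (hint : ∀ z : M, Valued.v z ≤ 1 → Valued.v ((z - ρ z) / (α - ρ α)) ≤ 1)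
    (hΘlam : Θ lam * lam = 1) (hvlam : Valued.v lam = 1) (hU : Valued.v (α - ρ α) = 1) (hτ : Valued.v (α - Θ α) < 1)
    (hσres : ∀ z : M, ρ z = z → Valued.v z ≤ 1 → Valued.v (Θ z - z) < 1)
    (hDM : IsRamifiedQuadraticDatum Θ (jE ϖ) d tE) (hjiso : ∀ a, Valued.v (jE a) = Valued.v a)
    (hq : Nat.card 𝓀[M] = Nat.card 𝓀[E] ^ 2) (hjpow : ∀ (t : E) (n : ℤ), Valued.v (jE t) = Valued.v (jE ϖ) ^ n ↔ Valued.v t = Valued.v ϖ ^ n)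
    (hϖmax : ∀ t : M, ρ t = t → Valued.v t < 1 → Valued.v t ≤ Valued.v (jE ϖ))
    (γ₂ : GL (Fin 2) E) (u : GL (Fin 1) E) (m jl : ℕ) (hm : Valued.v (lam - jE ((u : Matrix (Fin 1) (Fin 1) E) 0 0)) = WithZero.exp (-(m : ℤ)))
    (hjl : Valued.v ((lam - jE ((u : Matrix (Fin 1) (Fin 1) E) 0 0)) - ρ (lam - jE ((u : Matrix (Fin 1) (Fin 1) E) 0 0))) = WithZero.exp (-(jl : ℤ)))
    (hum : Valued.v (((u : Matrix (Fin 1) (Fin 1) E) 0 0) - 1) ≤ Valued.v (ϖ ^ mstarOfRecord d))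
    -- the general block
    (H₂ : Matrix (Fin 2) (Fin 2) E) (hW : E) (hH₂ : IsUnit H₂.det) (hH₂σ : (H₂.map σ)ᵀ = H₂) (hhW : Valued.v hW = 1) (hhWσ : σ hW = hW)
    (P₁ : GL (Fin 3) E) (hA : formCongr σ P₁ ((StdForm.antidiagonal 3).over E) = (!![H₂ 0 0, 0, H₂ 0 1; 0, hW, 0; H₂ 1 0, 0, H₂ 1 1] : Matrix (Fin 3) (Fin 3) E))
    (hΓ : P₁ * endoGL (γ₂, u) * P₁⁻¹ ∈ unitaryGroupOfForm σ ((StdForm.antidiagonal 3).over E))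
    (φ : (Fin 2 → E) →+ M) (h : M) (hφs : ∀ (c : E) (x : Fin 2 → E), φ (c • x) = jE c * φ x) (hφi : Function.Injective φ) (hφo : Function.Surjective φ)
    (hφγ : ∀ x, φ ((γ₂ : Matrix (Fin 2) (Fin 2) E).mulVec x) = lam * φ x)
    (hform : ∀ x y, jE (pairing σ H₂ x y) = h * Θ (φ x) * φ y + ρ (h * Θ (φ x) * φ y)) (hΘh : Θ h = h) (hh : h ≠ 0)
    (f : ℕ → ℕ → AddSubgroup M → ℕ) (hfinLS : ∀ j a, (levelSet ρ Θ α (jE ϖ) h j a).Finite)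
    (hf : ∀ (b j : ℕ) (Λ : AddSubgroup M) (x₀ : M) (r : E), 1 ≤ b → x₀ ≠ 0 → (∀ x, x ∈ Λ ↔ ∃ z, IsOrd ρ α (jE ϖ ^ j) z ∧ x = x₀ * z) →
      IsOrd ρ α (jE ϖ ^ j) (dualGen ρ Θ α (jE ϖ ^ j) h x₀) → ¬ IsOrd ρ α (jE ϖ ^ j) (dualGen ρ Θ α (jE ϖ ^ j) h x₀ / jE ϖ) → Valued.v (dualGen ρ Θ α (jE ϖ ^ j) h x₀) = Valued.v (jE ϖ) ^ b →
      (∀ b', (∀ x ∈ Λ, Valued.v (h * Θ x * b' + ρ (h * Θ x * b')) ≤ 1) → (lam - jE ((u : Matrix (Fin 1) (Fin 1) E) 0 0)) * b' ∈ Λ) → IsOrd ρ α (jE ϖ ^ j) lam →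
      jE r = glueUnit ρ Θ α (jE ϖ ^ j) h (jE ϖ) (jE hW) x₀ b →
      f b j Λ = Nat.card {x : 𝒪[E] ⧸ 𝓂[E] ^ (2 * b) // ∃ u' : 𝒪[E], Ideal.Quotient.mk (𝓂[E] ^ (2 * b)) u' = x ∧ Valued.v ((u' : E) * σ u' - r) ≤ Valued.v (ϖ ^ (2 * b))})
    -- the K6 floor (‹CORE.v1›'s `_hNm _hu1N _hlam1` at the assembler's fence value `N₀`, and `4d ≤ N₀`)
    {N₀ : ℕ} (h4d : 4 * d ≤ N₀) (hN₀m : N₀ ≤ m)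
    (hu1N : Valued.v (((u : Matrix (Fin 1) (Fin 1) E) 0 0) - 1) ≤ Valued.v (ϖ ^ N₀)) (hlam1 : Valued.v (lam - 1) ≤ Valued.v (jE ϖ ^ N₀))
    -- the live ODD row, the dyadic letter (‹CORE-ODD.v1›'s `_h2`) and the window
    (b : ℕ) (hb2 : 2 * b + 1 = m) (hd1 : d % 2 = 1) (h2 : ¬ IsUnit (2 : 𝒪[E])) {N : ℕ} (hNjl : m + 2 * N = jl)
    -- the inside chart (★ A1 p864708's letters)
    {κ₀ ξ₀ : M} (hκ₀ : κ₀ + ρ κ₀ = 1) (hΘκ₀ : Θ κ₀ = κ₀) (hκ₀v : Valued.v κ₀ = 1) (hξ : ρ ξ₀ = -ξ₀) (hΘξ : Θ ξ₀ = ξ₀)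
    (hξv : Valued.v ξ₀ * Valued.v (jE ϖ) ^ jl = Valued.v (jE ϖ) ^ (m + 2))
    {μa μb R₀ γ₀ : E} (hμab : lam - jE ((u : Matrix (Fin 1) (Fin 1) E) 0 0) = jE μa + jE μb * α)
    (hR₀ : jE R₀ = α * κ₀ + ρ (α * κ₀)) (hγ₀ : jE γ₀ = ξ₀ * (α - ρ α))
    {α₁ γ₁ : E} (hα₁σ : σ α₁ = α₁) (hα₁1 : Valued.v α₁ = 1) (hγ₁σ : σ γ₁ = γ₁) (hγ₁v : Valued.v γ₁ = Valued.v ϖ ^ 2)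
    (haff : ∀ (T W f : E), σ T = T → Valued.v T = 1 → σ W = W → Valued.v W ≤ 1 → σ f = f →
      Valued.v (T * ((μa + μb * R₀) * ((ϖ * σ ϖ) ^ b)⁻¹ + μb * γ₀ * ((ϖ * σ ϖ) ^ b)⁻¹ * W) - f * ((ϖ - σ ϖ) * ((ϖ * σ ϖ) ^ ((d - d % 2) / 2))⁻¹)) ≤
        Valued.v ϖ ^ mstarOfRecord d → normSign σ f = normSign σ T * normSign σ (α₁ + γ₁ * W))
    -- ONE fine digit system for the whole inside window
    (Rds : Finset E) {ns : ℕ} (hns : b + 2 * (N - 1) ≤ ns) (hRds1 : ∀ V ∈ Rds, σ V = V ∧ Valued.v V ≤ 1)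
    (hRds2 : ∀ V : E, σ V = V → Valued.v V ≤ 1 → ∃ V₀ ∈ Rds, Valued.v (V - V₀) ≤ Valued.v ϖ ^ ns)
    (hRds3 : ∀ V ∈ Rds, ∀ V' ∈ Rds, Valued.v (V - V') ≤ Valued.v ϖ ^ ns → V = V') :
    ∀ i : ℕ, i < N →
      (((∑ᶠ Λ ∈ levelSetDep ρ Θ α (jE ϖ) h (b + 2 * i) b (lam - jE ((u : Matrix (Fin 1) (Fin 1) E) 0 0)) ∩
                        {Λ | ∃ B : Submodule 𝒪[E] (Fin 2 → E), B.toAddSubgroup.map φ = Λ ∧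
                          ∃ L₃ : Submodule 𝒪[E] (Fin 3 → E), IsSelfDualLattice σ ϖ (!![H₂ 0 0, 0, H₂ 0 1; 0, hW, 0; H₂ 1 0, 0, H₂ 1 1] : Matrix (Fin 3) (Fin 3) E) L₃ ∧
                            L₃ ⊓ LinearMap.ker ((LinearMap.proj (1 : Fin 3) : (Fin 3 → E) →ₗ[E] E).restrictScalars 𝒪[E]) =
                              B.map ((Matrix.toLin' (!![1, 0; 0, 0; 0, 1] : Matrix (Fin 3) (Fin 2) E)).restrictScalars 𝒪[E]) ∧
                            (∀ c : E, (Pi.single 1 c : Fin 3 → E) ∈ L₃ ↔ Valued.v c ≤ Valued.v ϖ ^ b) ∧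
                            (LatticeNearTransvShell ϖ (d % 2) (mstarOfRecord d) ((((endoGL (γ₂, u) : GL (Fin 3) E) : Matrix (Fin 3) (Fin 3) E) - 1)) L₃ ∧
                              {z : E | ∃ y ∈ L₃, Valued.v ((ϖ ^ (mstarOfRecord d))⁻¹ * (z - pairing σ (!![H₂ 0 0, 0, H₂ 0 1; 0, hW, 0; H₂ 1 0, 0, H₂ 1 1] : Matrix (Fin 3) (Fin 3) E) y (((((endoGL (γ₂, u) : GL (Fin 3) E) : Matrix (Fin 3) (Fin 3) E) - 1)) *ᵥ y))) ≤ 1} =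
                                valueSetMod σ ϖ (mstarOfRecord d) (xPlus σ ϖ d))}, f b (b + 2 * i) Λ : ℕ) : ℤ) -
                    ((∑ᶠ Λ ∈ levelSetDep ρ Θ α (jE ϖ) h (b + 2 * i) b (lam - jE ((u : Matrix (Fin 1) (Fin 1) E) 0 0)) ∩
                        {Λ | ∃ B : Submodule 𝒪[E] (Fin 2 → E), B.toAddSubgroup.map φ = Λ ∧
                          ∃ L₃ : Submodule 𝒪[E] (Fin 3 → E), IsSelfDualLattice σ ϖ (!![H₂ 0 0, 0, H₂ 0 1; 0, hW, 0; H₂ 1 0, 0, H₂ 1 1] : Matrix (Fin 3) (Fin 3) E) L₃ ∧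
                            L₃ ⊓ LinearMap.ker ((LinearMap.proj (1 : Fin 3) : (Fin 3 → E) →ₗ[E] E).restrictScalars 𝒪[E]) =
                              B.map ((Matrix.toLin' (!![1, 0; 0, 0; 0, 1] : Matrix (Fin 3) (Fin 2) E)).restrictScalars 𝒪[E]) ∧
                            (∀ c : E, (Pi.single 1 c : Fin 3 → E) ∈ L₃ ↔ Valued.v c ≤ Valued.v ϖ ^ b) ∧
                            (LatticeNearTransvShell ϖ (d % 2) (mcOfRecord d) ((((endoGL (γ₂, u) : GL (Fin 3) E) : Matrix (Fin 3) (Fin 3) E) - 1)) L₃ ∧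
                              ¬ {z : E | ∃ y ∈ L₃, Valued.v ((ϖ ^ (mstarOfRecord d))⁻¹ * (z - pairing σ (!![H₂ 0 0, 0, H₂ 0 1; 0, hW, 0; H₂ 1 0, 0, H₂ 1 1] : Matrix (Fin 3) (Fin 3) E) y (((((endoGL (γ₂, u) : GL (Fin 3) E) : Matrix (Fin 3) (Fin 3) E) - 1)) *ᵥ y))) ≤ 1} =
                                valueSetMod σ ϖ (mstarOfRecord d) (xPlus σ ϖ d))}, f b (b + 2 * i) Λ : ℕ) : ℤ)) *
          ((Rds.filter (fun V₀ : E => Valued.v (κ₀ + jE V₀ * ξ₀) * Valued.v (jE ϖ ^ (b + 2 * i) * (α - ρ α)) = Valued.v (jE ϖ) ^ b ∧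
          ∃ e : M, ρ e = e ∧ e * Θ e = (κ₀ + jE V₀ * ξ₀) * ρ (κ₀ + jE V₀ * ξ₀) / (h * ρ h))).card : ℤ) =
        ((∑ᶠ Λ ∈ levelSetDep ρ Θ α (jE ϖ) h (b + 2 * i) b (lam - jE ((u : Matrix (Fin 1) (Fin 1) E) 0 0)), f b (b + 2 * i) Λ : ℕ) : ℤ) *
          (normSign σ (-hW) * ∑ V ∈ Rds.filter (fun V₀ : E => Valued.v (κ₀ + jE V₀ * ξ₀) * Valued.v (jE ϖ ^ (b + 2 * i) * (α - ρ α)) = Valued.v (jE ϖ) ^ b ∧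
          ∃ e : M, ρ e = e ∧ e * Θ e = (κ₀ + jE V₀ * ξ₀) * ρ (κ₀ + jE V₀ * ξ₀) / (h * ρ h)), normSign σ (α₁ + γ₁ * V)) := by
  intro i hi
  classical
  obtain ⟨hσσ, hvσ, hϖ, hfix, hdiff, -, -⟩ := id hD
  obtain ⟨-, hϖlt, -, hvjϖ0, -, -, -⟩ := uniformizer_letters jE hjv hϖ
  -- the cell's own digit system modulo `|ϖ|^{b + 2(N−1−i)}` (★ `exists_repr_fixedBall_card (t := 0)`)
  obtain ⟨Rd, hRd1', hRd2', hRd3', -⟩ := exists_repr_fixedBall_card hσσ hvσ hfix hϖ hdiff (b + 2 * (N - 1 - i)) 0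
  have h10 : Valued.v ϖ ^ (2 * 0) = 1 := by rw [mul_zero, pow_zero]
  have hρ0 : b + 2 * (N - 1 - i) + 2 * 0 = b + 2 * (N - 1 - i) := by rw [mul_zero, add_zero]
  have hRd1 : ∀ V ∈ Rd, σ V = V ∧ Valued.v V ≤ 1 := fun V hV => ⟨(hRd1' V hV).1, h10 ▸ (hRd1' V hV).2⟩
  have hRd2 : ∀ V : E, σ V = V → Valued.v V ≤ 1 → ∃ V₀ ∈ Rd, Valued.v (V - V₀) ≤ Valued.v ϖ ^ (b + 2 * (N - 1 - i)) := fun V hσV hV1 => by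
    obtain ⟨V₀, hV₀, hVV₀⟩ := hRd2' V hσV (h10.symm ▸ hV1)
    exact ⟨V₀, hV₀, hρ0 ▸ hVV₀⟩
  have hRd3 : ∀ V ∈ Rd, ∀ V' ∈ Rd, Valued.v (V - V') ≤ Valued.v ϖ ^ (b + 2 * (N - 1 - i)) → V = V' :=
    fun V hV V' hV' hVV' => hRd3' V hV V' hV' (hρ0.symm ▸ hVV')
  -- §1: ★ F1b-ODD on the cell and its own system
  have hlaw := insideCell_law_coarse_odd σ ϖ d tE hD jE ρ Θ α lam hρρ hvρ hjv hjfix hΘj hΘΘ hΘρ hvΘ hα hα1 hint hΘlam hvlam hU hτ hσres hDM hjiso hq hjpow hϖmax γ₂ u m jl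
    hm hjl hum H₂ hW hH₂ hH₂σ hhW hhWσ P₁ hA hΓ φ h hφs hφi hφo hφγ hform hΘh hh f hfinLS hf h4d hN₀m hu1N hlam1 b hb2 hd1 h2 hNjl hκ₀ hΘκ₀ hκ₀v hξ hΘξ hξv hμab hR₀ hγ₀
    hα₁σ hα₁1 hγ₁σ hγ₁v haff hi Rd hRd1 hRd2 hRd3
  -- ★ A2r: the literal predicate and the label are class functions modulo the cell's resolution
  have hdb : 2 * d ≤ b := by omega
  obtain ⟨-, hrR, hr₀, hrγ⟩ := precisionLetters_insideCell hD jE hjiso hU (m := 2 * b) (jl := 2 * b + 2 * N) rfl rfl hdb hi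
    (v_xi_shift_odd hD jE hjiso hb2 hNjl hξv) hγ₁v
  have hC : Valued.v (jE ϖ ^ (b + 2 * i) * (α - ρ α)) ≠ 0 := by
    rw [Valuation.map_mul, hU, mul_one, Valuation.map_pow]; exact pow_ne_zero _ hvjϖ0
  have hγ₁1 : Valued.v γ₁ < 1 := by rw [hγ₁v]; exact pow_lt_one₀ zero_le hϖlt (by norm_num)
  exact cellLaw_fine_of_coarse hD jE hjfix hΘj hjiso hρρ hvρ hΘρ hκ₀ hΘκ₀ hκ₀v hξ hΘξ (h * ρ h) (jE ϖ ^ (b + 2 * i) * (α - ρ α)) (Valued.v (jE ϖ) ^ b) hC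
    hα₁σ hα₁1 hγ₁σ hγ₁1 _ (fun _ _ _ => Iff.rfl) Rd Rds (by omega) hRd1 hRd2 hRd3 hRds1 hRds2 hRds3 hrR hr₀ hrγ _ _ _ hlaw

end Summit.HodgeConjecture.HodgeConjecture.Cruxes.H413.F0P3cDyRamInsideCellsLawFineOdd

end
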